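import Summits.HubbardSuperconductivity.HubbardSuperconductivity.Theses.PlaquetteBoson
import Summits.HubbardSuperconductivity.HubbardSuperconductivity.Theses.AnisotropyChord
import Summits.HubbardSuperconductivity.HubbardSuperconductivity.Theses.PolyaSchurPairBoson
import Summits.HubbardSuperconductivity.HubbardSuperconductivity.Theorems.PlaquetteBosonPbInterpolation

/-!
# Route `PlaquetteBoson`, crux `PbAnchorOrder` (stmt-HubbardSuperconductivity-0905) — SPLIT GLUE and the
# dissection of the anchor into existing items (crux-strategist, 2026-08-17)

The anchor crux `PbAnchorOrder` (`∃ U > 0, ∃ δ ∈ (0,1/2), ∃ t₀ > 0, ∀ t' ∈ (0,t₀)`: `d`-wave pair LRO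
`c(t')·L⁴ ≤ re⟨ψ, Δ_d†Δ_d ψ⟩` for every `(N_L, S^z = 0)`-sector ground state of the checkerboard Hubbard
torus, eventually in `L ∈ 4ℕ`) is, LITERALLY, the conclusion of two implication-shaped items that other
routes of the summit already file and staff:

* `AnisotropyChord.DressHalfFilled` (stmt-HubbardSuperconductivity-8148, shared with `LevyLogBootstrap`)
  is by `Iff.rfl` the implication `PlaquetteBoson.PbHalfFilledXYOrder → PlaquetteBoson.PbAnchorOrder`
  (`dressHalfFilled_iff`): its antecedent is this route's own crux stmt-0906 verbatim and its consequent is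
  stmt-0905 verbatim (witness doping `δ = 1/4`, i.e. boson half filling `S^z_tot = 0`, the reflection-positive
  sector — no monotone depletion is needed for the ITEM);
* `PolyaSchurPairBoson.DressAnyFilling` (stmt-10291) is by `Iff.rfl` the implication
  `PolyaSchurPairBoson.EasyPlaneCondensate → PlaquetteBoson.PbAnchorOrder` (`dressAnyFilling_iff`), and
  `EasyPlaneCondensate` (stmt-10288) is (a) the consequent of this route's PROVED support `PbInterpolation`
  (`easyPlaneCondensate_of_routeItems`: stmt-0904 + stmt-0906 give it) and (b) implies `PbHalfFilledXYOrder`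
  by instantiating the filling `ρ = 1/2` (`pbHalfFilledXYOrder_of_easyPlaneCondensate`), so that
  `DressHalfFilled → DressAnyFilling` (`dressAnyFilling_of_dressHalfFilled`).

Hence the SPLIT of the crux filed by the strategist: `PbAnchorOrder ⟸ PbHalfFilledXYOrder ∧ DressHalfFilled`
(`PbAnchorOrder_of_subs`, modus ponens), together with the two other closed corners
`PbAnchorOrder_of_easyPlane_of_dressAnyFilling` (stmt-10288 ∧ stmt-10291) and
`PbAnchorOrder_of_routeItems` (stmt-0904 ∧ stmt-0906 ∧ stmt-10291). All statements are pure logic /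
elementary real arithmetic on the literal route terms; no definition and no named fact is introduced.
Sources (context only): H. Yao, W.-F. Tsai, S. A. Kivelson, PRB 76 (2007) 161104(R) [YaoTsaiKivelson2007]
(the checkerboard dictionary, boson filling `ρ_b = 2δ`); T. Kennedy, E. H. Lieb, B. S. Shastry, PRL 61
(1988) 2582 [KLS1988PRL] (the half-filled reflection-positive point).
-/

set_option linter.dupNamespace false

noncomputable section

namespace Summit.HubbardSuperconductivity.HubbardSuperconductivity.Theorems.PlaquetteBoson

open scoped BigOperators Matrix ComplexOrder
open Matrix Complex Finset
open Literature.MathematicalPhysics.QuantumLattice Literature.Probability.LatticeModels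
open Summit.HubbardSuperconductivity.HubbardSuperconductivity.Theses
open Summit.HubbardSuperconductivity.HubbardSuperconductivity.Theses.PlaquetteBoson

/-! ## §1 The two dressing items are implications INTO this crux (by `Iff.rfl`) -/

/-- `AnisotropyChord.DressHalfFilled` (stmt-8148) is literally `PbHalfFilledXYOrder → PbAnchorOrder`
(stmt-0906 → stmt-0905). [bookkeeping] -/
theorem dressHalfFilled_iff :
    AnisotropyChord.DressHalfFilled ↔ (PbHalfFilledXYOrder → PbAnchorOrder) :=
  Iff.rfl

/-- `PolyaSchurPairBoson.DressAnyFilling` (stmt-10291) is literally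
`EasyPlaneCondensate → PbAnchorOrder` (stmt-10288 → stmt-0905). [bookkeeping] -/
theorem dressAnyFilling_iff :
    PolyaSchurPairBoson.DressAnyFilling ↔ (PolyaSchurPairBoson.EasyPlaneCondensate → PbAnchorOrder) :=
  Iff.rfl

/-- `PolyaSchurPairBoson.AnchorOrder` is this crux verbatim (shared item stmt-0905). [bookkeeping] -/
theorem psbAnchorOrder_iff : PolyaSchurPairBoson.AnchorOrder ↔ PbAnchorOrder :=
  Iff.rfl

/-- `AnisotropyChord.AnchorOrder` is this crux verbatim (shared item stmt-0905). [bookkeeping] -/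
theorem acAnchorOrder_iff : AnisotropyChord.AnchorOrder ↔ PbAnchorOrder :=
  Iff.rfl

/-! ## §2 The split glue: `PbAnchorOrder ⟸ PbHalfFilledXYOrder ∧ DressHalfFilled` -/

/-- **SPLIT GLUE (crux-strategist, stmt-0905).** The anchor crux follows from this route's crux
`PbHalfFilledXYOrder` (stmt-0906: half-filled easy-plane XY order of the `S = ½` XXZ torus on `(−1,0]`) and
the shared dressing item `AnisotropyChord.DressHalfFilled` (stmt-8148: that order, dressed through the
checkerboard Schrieffer–Wolff reduction at boson half filling `δ = 1/4`, gives the anchor) — by modus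
ponens. [bookkeeping] -/
theorem PbAnchorOrder_of_subs (hHF : PbHalfFilledXYOrder) (hD : AnisotropyChord.DressHalfFilled) :
    PbAnchorOrder :=
  dressHalfFilled_iff.mp hD hHF

/-- The same glue read as a proof of the shared support `PolyaSchurPairBoson.AnchorOrder` (stmt-0905 under
its `PolyaSchurPairBoson` name). [bookkeeping] -/
theorem psbAnchorOrder_of_subs (hHF : PbHalfFilledXYOrder) (hD : AnisotropyChord.DressHalfFilled) :
    PolyaSchurPairBoson.AnchorOrder :=
  psbAnchorOrder_iff.mpr (PbAnchorOrder_of_subs hHF hD)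

/-- The same glue read as a proof of the shared support `AnisotropyChord.AnchorOrder` (stmt-0905 under its
`AnisotropyChord` name). [bookkeeping] -/
theorem acAnchorOrder_of_subs (hHF : PbHalfFilledXYOrder) (hD : AnisotropyChord.DressHalfFilled) :
    AnisotropyChord.AnchorOrder :=
  acAnchorOrder_iff.mpr (PbAnchorOrder_of_subs hHF hD)

/-! ## §3 The any-filling corner: `EasyPlaneCondensate` gives the half-filled order, so `8148 ⇒ 10291` -/

/-- For even `M`, the half-filled boson number `N = M²/2` is a natural number with `(N : ℝ) = M²/2`.
[folklore] -/
private theorem halfFilled_count (M : ℕ) (hM : Even M) :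
    ∃ N : ℕ, 2 * N = M ^ 2 ∧ ((N : ℝ) - (M : ℝ) ^ 2 / 2) = 0 ∧ (1 / 2 : ℝ) * (M : ℝ) ^ 2 ≤ (N : ℝ) := by
  obtain ⟨k, rfl⟩ := hM
  refine ⟨2 * k ^ 2, by ring, ?_, ?_⟩
  · push_cast; ring
  · push_cast; nlinarith [sq_nonneg (k : ℝ)]

/-- **`EasyPlaneCondensate → PbHalfFilledXYOrder`**: instantiate the filling window at `ρ = 1/2`, where the
only admissible boson number is `N = M²/2` and the sector label `N − M²/2` is `0`. [bookkeeping] -/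
theorem pbHalfFilledXYOrder_of_easyPlaneCondensate (h : PolyaSchurPairBoson.EasyPlaneCondensate) :
    PbHalfFilledXYOrder := by
  intro Δ hΔ
  obtain ⟨c, hc, M₀, hM₀⟩ := h Δ hΔ (1 / 2) ⟨by norm_num, by norm_num⟩
  refine ⟨c, hc, M₀, ?_⟩
  intro M _ hME hMM ψ hψ hψ1 hH
  obtain ⟨N, h2N, hN0, hρN⟩ := halfFilled_count M hME
  have key := hM₀ M hME hMM N hρN (by exact_mod_cast h2N.le) ψ
  rw [hN0] at key
  exact key hψ hψ1 hH

/-- **`DressHalfFilled → DressAnyFilling`** (stmt-8148 ⇒ stmt-10291): the any-filling condensate contains the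
half-filled order. [bookkeeping] -/
theorem dressAnyFilling_of_dressHalfFilled (hD : AnisotropyChord.DressHalfFilled) :
    PolyaSchurPairBoson.DressAnyFilling :=
  fun hEP => hD (pbHalfFilledXYOrder_of_easyPlaneCondensate hEP)

/-- `EasyPlaneCondensate` (stmt-10288) is verbatim the consequent of this route's proved support
`PbInterpolation`, so the route's cruxes stmt-0904 + stmt-0906 give it. [bookkeeping] -/
theorem easyPlaneCondensate_of_routeItems (hMD : PbMonotoneDepletion) (hHF : PbHalfFilledXYOrder) :
    PolyaSchurPairBoson.EasyPlaneCondensate :=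
  pbInterpolation_proof hMD hHF

/-! ## §4 The other two closed corners of the dissection -/

/-- The anchor from the `PolyaSchurPairBoson` pair stmt-10288 ∧ stmt-10291 (modus ponens). [bookkeeping] -/
theorem PbAnchorOrder_of_easyPlane_of_dressAnyFilling (hEP : PolyaSchurPairBoson.EasyPlaneCondensate)
    (hDA : PolyaSchurPairBoson.DressAnyFilling) : PbAnchorOrder :=
  dressAnyFilling_iff.mp hDA hEP

/-- The anchor from this route's stmt-0904 ∧ stmt-0906 and the dressing stmt-10291 (through the proved
`PbInterpolation`). [bookkeeping] -/
theorem PbAnchorOrder_of_routeItems (hMD : PbMonotoneDepletion) (hHF : PbHalfFilledXYOrder)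
    (hDA : PolyaSchurPairBoson.DressAnyFilling) : PbAnchorOrder :=
  hDA (easyPlaneCondensate_of_routeItems hMD hHF)

/-- Conversely the anchor gives the half-filled dressing item for free (it is an implication into it):
as an ITEM, `DressHalfFilled` is the anchor MODULO its antecedent stmt-0906. [bookkeeping] -/
theorem dressHalfFilled_of_PbAnchorOrder (hA : PbAnchorOrder) : AnisotropyChord.DressHalfFilled :=
  dressHalfFilled_iff.mpr fun _ => hA

/-- Likewise the any-filling dressing item: `PbAnchorOrder → DressAnyFilling`. [bookkeeping] -/
theorem dressAnyFilling_of_PbAnchorOrder (hA : PbAnchorOrder) : PolyaSchurPairBoson.DressAnyFilling :=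
  dressAnyFilling_iff.mpr fun _ => hA

end Summit.HubbardSuperconductivity.HubbardSuperconductivity.Theorems.PlaquetteBoson

end
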